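import Summits.ResolutionOfSingularities.ResolutionOfSingularities.Theorems.AQSHeightTwoPlusStalkPoint
import Summits.ResolutionOfSingularities.ResolutionOfSingularities.Theorems.AQSHeightTwoOrderReadOff
import Summits.ResolutionOfSingularities.ResolutionOfSingularities.Theorems.WeightedInvariantLexMaxOrderDropOrder
import HarnessLib

/-!
# (o25) «F-AQS-T in the kernel» — clause (5) of the on-`Y` centre package CLOSED: the order of the strict transform drops at
# every point of `B₊(U)` over `η` (PLUS-STALK (γ2) ∘ LOCAL DROP (β))

Route `ResolutionOfSingularities/WeightedInvariant`, crux `Theses.WeightedInvariant.HypersurfaceCentreConstruction`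
(stmt-ResolutionOfSingularities-19897), door line `local-engine`, rung `e = 1`, ORDER (o25) of res-L1-w43-plan-1 (make the named fact
`AbramovichQuekSchober2025_heightTwoCentre` a kernel theorem; `_holds` assembly res-type-092 through res-type-070's
`AQSHeightTwo.heightTwoCentre_of_onScheme`).  The last conjunct of the on-`Y` package,
`∀ b : R.cobordantPlus U, R.cobordantPlusι U b = η → idealOrder (R.cobordantStrictTransform U X) b < idealOrder X η`,
is assembled here from the two halves already in the tree:
* PLUS-STALK (γ2) (res-type-089 / res-type-057): `ReesAlgebraData.IsWeightedChart.idealOrder_cobordantStrictTransform_lt_of_localDrop`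
  (`AQSHeightTwoPlusStalkPoint.lean`) — clause (5) from a local drop over `S = 𝒪_{Y,η}`;
* LOCAL DROP (β) (res-type-098): `LexMaxOrderDrop.adicOrder_transform_lt_of_isLexMax` (`WeightedInvariantLexMaxOrderDropOrder.lean`) — for
  the lex-maximal admissible centre germ `(x; w; ℓ)` of `(f)`, `ℓ = w 0 · ν`, `2 ≤ ν = ord f`, every `t⁻¹`-primitive factorisation
  `f = (t⁻¹)ᵃ g` at a prime `𝔫 ∋ t⁻¹` over `𝔪_S`, off the vertex, has `adicOrder (g/1) < ν`;
and res-type-057's `idealOrder_eq_adicOrder_of_stalkIdeal_eq_span` (`AQSHeightTwoOrderReadOff.lean`) to read `ord_η X = ord f`.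

* **`ReesAlgebraData.IsWeightedChart.idealOrder_cobordantStrictTransform_lt_of_isLexMax`** — `∀ b` over `η`, `idealOrder … b < ν`;
* **`ReesAlgebraData.IsWeightedChart.idealOrder_cobordantStrictTransform_lt_idealOrder`** — the package's clause (5) verbatim
  (`< idealOrder X η`), keyed on clause (3) `((ℓ / w 0 : ℕ) : ℕ∞) = idealOrder X η` and `2 ≤ ℓ / w 0`.

Def-free helper (`--supports stmt-ResolutionOfSingularities-19897`); OURS bookkeeping — nothing here is a claim about resolution of
singularities in positive characteristic or about the cited paper beyond its typed statement.  AI-written; weaker than expert review.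
[cite: AbramovichQuekSchober2025, Thm 1.3 (3)] [cite: Wlodarczyk2022, 3.3.12; Def. 5.1.1]
-/

noncomputable section

set_option linter.dupNamespace false -- mandated namespace of this single-conjunct summit

open CategoryTheory AlgebraicGeometry TopologicalSpace IsLocalRing
open scoped LaurentPolynomial
open Literature.AlgebraicGeometry.Resolution
open Summit.ResolutionOfSingularities.ResolutionOfSingularities.Theorems

namespace Summit.ResolutionOfSingularities.ResolutionOfSingularities.Theorems.AQSHeightTwo

variable {Y : Scheme.{0}} (R : ReesAlgebraData Y) (U : Y.affineOpens)

/-- **Clause (5), `ν`-form.**  `(U, u, w)` a weighted chart of `R` on `Y`, `η ∈ U` with `𝒪_{Y,η}` regular of dimension `2`, `x` the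
germs of `u` at `η`, `X` an ideal sheaf with `X_η = (f)`, and `(x; w; ℓ)` THE lex-maximal admissible weighted centre germ of `(f)` with
`ℓ = w 0 · ν`, `2 ≤ ν = ord f`.  Then `idealOrder (R.cobordantStrictTransform U X) b < ν` at every `b : B₊(U)` over `η`.
[cite: AbramovichQuekSchober2025, Thm 1.3 (3)] [cite: Wlodarczyk2022, 3.3.12] -/
theorem _root_.Literature.AlgebraicGeometry.Resolution.ReesAlgebraData.IsWeightedChart.idealOrder_cobordantStrictTransform_lt_of_isLexMax
    {u : Fin 2 → Γ(Y, U)} {w : Fin 2 → ℕ} (hchart : R.IsWeightedChart U u w)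
    {η : Y} (hη : η ∈ (U : Y.Opens)) [IsRegularLocalRing (Y.presheaf.stalk η)]
    (hdim : ringKrullDim (Y.presheaf.stalk η) = 2) {x : Fin 2 → Y.presheaf.stalk η}
    (hx : ∀ i, (Y.presheaf.germ (U : Y.Opens) η hη).hom (u i) = x i)
    (X : Y.IdealSheafData) {f : Y.presheaf.stalk η} (hf : stalkIdeal X η = Ideal.span {f})
    {ℓ ν : ℕ} (hlex : IsLexMaxWeightedCentreGerm (Y.presheaf.stalk η) (Ideal.span {f}) x w ℓ) (hℓ : ℓ = w 0 * ν)
    (hν : 2 ≤ ν) (hord : adicOrder f = (ν : ℕ∞)) :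
    ∀ b : R.cobordantPlus U, R.cobordantPlusι U b = η → idealOrder (R.cobordantStrictTransform U X) b < (ν : ℕ∞) := by
  -- the germs lie in `𝔪_η` (they span it), `f ∉ 𝔪^{ν+1}`, and the weights are bounded by `w 0 > 0`
  have hxm : ∀ i, x i ∈ maximalIdeal (Y.presheaf.stalk η) := fun i =>
    hlex.1 ▸ Ideal.subset_span ⟨i, rfl⟩
  have hfk : f ∉ maximalIdeal (Y.presheaf.stalk η) ^ (ν + 1) := (adicOrder_le_iff f ν).mp hord.le
  have hW0 : 0 < w 0 := hlex.2.1 0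
  have hW : ∀ i, w i ≤ w 0 := by
    refine Fin.forall_fin_two.mpr ⟨le_rfl, hlex.2.2.2.1⟩
  exact hchart.idealOrder_cobordantStrictTransform_lt_of_localDrop_of_not_mem_pow R U hη hx hxm X hf hfk hW0 hW
    (LexMaxOrderDrop.adicOrder_transform_lt_of_isLexMax hdim hlex hℓ hν hord)

/-- **Clause (5) of the on-`Y` package of `AbramovichQuekSchober2025_heightTwoCentre`, verbatim.**  Same data, keyed on clause (3)
`((ℓ / w 0 : ℕ) : ℕ∞) = idealOrder X η` and `2 ≤ ℓ / w 0`: at every `b : B₊(U)` over `η`,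
`idealOrder (R.cobordantStrictTransform U X) b < idealOrder X η`. [cite: AbramovichQuekSchober2025, Thm 1.3 (3)] [cite: Wlodarczyk2022, 3.3.12] -/
theorem _root_.Literature.AlgebraicGeometry.Resolution.ReesAlgebraData.IsWeightedChart.idealOrder_cobordantStrictTransform_lt_idealOrder
    {u : Fin 2 → Γ(Y, U)} {w : Fin 2 → ℕ} (hchart : R.IsWeightedChart U u w)
    {η : Y} (hη : η ∈ (U : Y.Opens)) [IsRegularLocalRing (Y.presheaf.stalk η)]
    (hdim : ringKrullDim (Y.presheaf.stalk η) = 2) {x : Fin 2 → Y.presheaf.stalk η}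
    (hx : ∀ i, (Y.presheaf.germ (U : Y.Opens) η hη).hom (u i) = x i)
    (X : Y.IdealSheafData) {f : Y.presheaf.stalk η} (hf : stalkIdeal X η = Ideal.span {f})
    {ℓ : ℕ} (hlex : IsLexMaxWeightedCentreGerm (Y.presheaf.stalk η) (Ideal.span {f}) x w ℓ)
    (hν : 2 ≤ ℓ / w 0) (hord : ((ℓ / w 0 : ℕ) : ℕ∞) = idealOrder X η) :
    ∀ b : R.cobordantPlus U, R.cobordantPlusι U b = η →
      idealOrder (R.cobordantStrictTransform U X) b < idealOrder X η := by
  have hordf : adicOrder f = ((ℓ / w 0 : ℕ) : ℕ∞) := by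
    rw [← idealOrder_eq_adicOrder_of_stalkIdeal_eq_span X η hf]
    exact hord.symm
  have hℓ : ℓ = w 0 * (ℓ / w 0) := (Nat.mul_div_cancel' hlex.2.2.2.2.2.1).symm
  rw [← hord]
  exact hchart.idealOrder_cobordantStrictTransform_lt_of_isLexMax R U hη hdim hx X hf hlex hℓ hν hordf

end Summit.ResolutionOfSingularities.ResolutionOfSingularities.Theorems.AQSHeightTwo

end
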